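import Mathlib
import Summits.AtomisticToContinuum.HydrodynamicLimit.Theorems.ImplosionDichotomyDenseExcursionSonicCavityDefsC

/-!
# Pointwise coefficient bounds of the slaved gauge along the sonic-slaving contour, from the proposed loop clause
# (crux `DenseExcursion`, line `sonic-cavity-renewal` v7, brick (M4)-(P4) for the registered stub `stub_sonicSlaving`)

Helper file (`--supports stmt-AtomisticToContinuum-12586`, line lead a2, stub-worker A (wave 3) for `stub_sonicSlaving`).

Pure complex-number algebra: at one point of the contour, write `w, s, w₁, s₁, w₂, s₂` for the values of `Wc, Sc` and their first two
derivatives, `c± = w − 1 ± s`, `b₊₊ = ⅔w₁ + 2w − r + 2s₁ + 4s`, `b₋₋ = ⅔w₁ + 2w − r − 2s₁ − 4s`, `b₊₋ = w₁/3 + s₁ + 2s`,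
`b₋₊ = w₁/3 − s₁ − 2s`, `k₁ = c₊/c₋`, `Q = (Λ − b₊₊) − k₁(Λ − b₋₋)`, `ρ = b₊₋/Q`, `α = −b₋₊/c₋`, `h = 1/c₊ − 1/c₋`,
`q = (Λ − b₊₊)/c₊ − (Λ − b₋₋)/c₋ = Λ h − b₊₊/c₊ + b₋₋/c₋`, and for a tangent `τ`: `D₁ = −Im(τh)`, `D₂ = Re(τh)`, `D₃ = Re(−b₊₊τ/c₊ + b₋₋τ/c₋)`.
Under the sup bounds (L) of the proposed loop clause (`‖α‖ ≤ 4/5`, `‖b₊₋‖ ≤ 2`, `‖k₁‖ ≤ 9/25`, `‖b₊₊‖ ≤ 3`, `‖b₋₋‖ ≤ 5`, …) and the rate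
range `Im Λ ≥ 1000`, `−1/4 ≤ Re Λ ≤ 3`:

* `norm_charQ_ge` — `‖Q‖ ≥ (127/200)·Im Λ` (so `Q ≠ 0` and `‖ρ‖ ≤ 400/(127 Im Λ)`);
* `re_transport_eq` — the transport exponent of the slaved gauge along `y′ = c τ` is
  `Re((cτ)(q − αρ)) = c (Im Λ·D₁ + Re Λ·D₂ + D₃ − Re(αρτ))`;
* `re_transport_nonneg` — the clause triple `D₁ ≥ 0`, `1000 D₁ − D₂/4 + D₃ ≥ 1`, `1000 D₁ + 3D₂ + D₃ ≥ 1` (affine in `Λ`: the two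
  corners `Re Λ ∈ {−1/4, 3}` at `Im Λ = 1000` suffice) makes it `≥ 0`;
* `re_transport_ge_vertical` — on the first leg (`τ = −η i`, `Re h ≥ 8/5`, `|Im h| ≤ 2/5`, `|Im(b₊₊/c₊ − b₋₋/c₋)| ≤ 2/5`) it is
  `≥ 1598·c·η`: the steepness `λ` of `loop_slaving_estimate`.

* `norm_charQderiv_le`, `norm_slavedForcing_le` — `‖Q′‖ ≤ (3/5) Im Λ + 256/25` and the forcing `‖ρ′ + αρ²‖ ≤ (25/4)/Im Λ`
  (`ρ′ = (b₊₋′Q − b₊₋Q′)/Q²`), the budgets `f₁`, `Φ` of `loop_slaving_estimate`.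

NOT here: anything about functions (the identification of these numbers with the values of `Wc, Sc, …` along the contour is the
assembly's job). No citation is load-bearing.
-/

noncomputable section

open Complex

namespace Summit.AtomisticToContinuum.HydrodynamicLimit.Theorems.SonicCavityRenewal

/-- **Lower bound for `Q = Λ(1 − k₁) − b₊₊ + k₁ b₋₋`**: with `‖k₁‖ ≤ 9/25`, `‖b₊₊‖ ≤ 3`, `‖b₋₋‖ ≤ 5` and `Im Λ ≥ 1000`,
`‖Q‖ ≥ (16/25)·Im Λ − 24/5 ≥ (127/200)·Im Λ`. [folklore] -/
theorem norm_charQ_ge {Λ k₁ bpp bmm : ℂ} (hk : ‖k₁‖ ≤ 9 / 25) (hbpp : ‖bpp‖ ≤ 3) (hbmm : ‖bmm‖ ≤ 5) (hΛ : 1000 ≤ Λ.im) :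
    127 / 200 * Λ.im ≤ ‖(Λ - bpp) - k₁ * (Λ - bmm)‖ := by
  have h1 : ‖Λ * (1 - k₁)‖ ≥ Λ.im * (16 / 25) := by
    rw [norm_mul]
    have ha : Λ.im ≤ ‖Λ‖ := le_trans (le_abs_self _) (Complex.abs_im_le_norm Λ)
    have hb : (16 / 25 : ℝ) ≤ ‖1 - k₁‖ := by
      have := norm_sub_norm_le (1 : ℂ) k₁
      rw [norm_one] at this
      linarith
    have hΛ0 : 0 ≤ Λ.im := by linarith
    calc Λ.im * (16 / 25) ≤ ‖Λ‖ * (16 / 25) := by nlinarith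
      _ ≤ ‖Λ‖ * ‖1 - k₁‖ := mul_le_mul_of_nonneg_left hb (norm_nonneg _)
  have h2 : ‖k₁ * bmm‖ ≤ 9 / 25 * 5 := by
    rw [norm_mul]; exact mul_le_mul hk hbmm (norm_nonneg _) (by norm_num)
  have heq : (Λ - bpp) - k₁ * (Λ - bmm) = Λ * (1 - k₁) - bpp + k₁ * bmm := by ring
  rw [heq]
  have h3 : ‖Λ * (1 - k₁)‖ ≤ ‖Λ * (1 - k₁) - bpp + k₁ * bmm‖ + ‖bpp‖ + ‖k₁ * bmm‖ := by
    have e : Λ * (1 - k₁) = (Λ * (1 - k₁) - bpp + k₁ * bmm) + (bpp - k₁ * bmm) := by ring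
    calc ‖Λ * (1 - k₁)‖ = ‖(Λ * (1 - k₁) - bpp + k₁ * bmm) + (bpp - k₁ * bmm)‖ := by rw [← e]
      _ ≤ ‖Λ * (1 - k₁) - bpp + k₁ * bmm‖ + ‖bpp - k₁ * bmm‖ := norm_add_le _ _
      _ ≤ ‖Λ * (1 - k₁) - bpp + k₁ * bmm‖ + (‖bpp‖ + ‖k₁ * bmm‖) := by linarith [norm_sub_le bpp (k₁ * bmm)]
      _ = _ := by ring
  linarith

/-- `Q ≠ 0` and the slaving coefficient is `O(1/Im Λ)`: `‖b₊₋/Q‖ ≤ 400/(127·Im Λ)` when `‖b₊₋‖ ≤ 2`. [folklore] -/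
theorem norm_slaving_le {Λ k₁ bpp bmm bpm : ℂ} (hk : ‖k₁‖ ≤ 9 / 25) (hbpp : ‖bpp‖ ≤ 3) (hbmm : ‖bmm‖ ≤ 5) (hbpm : ‖bpm‖ ≤ 2)
    (hΛ : 1000 ≤ Λ.im) :
    (Λ - bpp) - k₁ * (Λ - bmm) ≠ 0 ∧ ‖bpm / ((Λ - bpp) - k₁ * (Λ - bmm))‖ ≤ 400 / (127 * Λ.im) := by
  have hQ := norm_charQ_ge hk hbpp hbmm hΛ
  have hQpos : 0 < ‖(Λ - bpp) - k₁ * (Λ - bmm)‖ := by nlinarith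
  refine ⟨norm_pos_iff.1 hQpos, ?_⟩
  rw [norm_div, div_le_div_iff₀ hQpos (by nlinarith)]
  nlinarith

/-- **THE TRANSPORT EXPONENT OF THE SLAVED GAUGE**, as an affine function of `Λ`: with `q = Λh − b₊₊/c₊ + b₋₋/c₋`, `h = 1/c₊ − 1/c₋`,
`Re((cτ) q − (cτ) αρ) = c (Im Λ·(−Im(τh)) + Re Λ·Re(τh) + Re(−b₊₊τ/c₊ + b₋₋τ/c₋) − Re(αρτ))`. [folklore] -/
theorem re_transport_eq (Λ τ cp cm bpp bmm α ρ : ℂ) (c : ℝ) :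
    ((c : ℂ) * τ * ((Λ - bpp) / cp - (Λ - bmm) / cm) - (c : ℂ) * τ * α * ρ).re =
      c * (Λ.im * (-(τ * (1 / cp - 1 / cm)).im) + Λ.re * (τ * (1 / cp - 1 / cm)).re +
        (-(bpp * τ / cp) + bmm * τ / cm).re - (α * ρ * τ).re) := by
  have heq : (c : ℂ) * τ * ((Λ - bpp) / cp - (Λ - bmm) / cm) - (c : ℂ) * τ * α * ρ =
      (c : ℂ) * (Λ * (τ * (1 / cp - 1 / cm)) + (-(bpp * τ / cp) + bmm * τ / cm) - α * ρ * τ) := by ring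
  rw [heq, Complex.re_ofReal_mul]
  congr 1
  simp only [Complex.add_re, Complex.sub_re, Complex.mul_re]
  ring

/-- **The clause triple makes the exponent non-negative for every admissible rate.** If `D₁ ≥ 0`, `1000 D₁ − D₂/4 + D₃ ≥ 1`,
`1000 D₁ + 3 D₂ + D₃ ≥ 1`, then for `Im Λ ≥ 1000`, `−1/4 ≤ Re Λ ≤ 3`: `Im Λ·D₁ + Re Λ·D₂ + D₃ ≥ 1` (convex combination of the two
corner conditions plus monotonicity in `Im Λ`). [folklore] -/
theorem transport_core_ge_one : ∀ (D₁ D₂ D₃ lI lR : ℝ), 0 ≤ D₁ → 1 ≤ 1000 * D₁ - D₂ / 4 + D₃ → 1 ≤ 1000 * D₁ + 3 * D₂ + D₃ → 1000 ≤ lI → -(1 / 4 : ℝ) ≤ lR → lR ≤ 3 → 1 ≤ lI * D₁ + lR * D₂ + D₃ := by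
  intro D₁ D₂ D₃ lI lR h1 h2 h3 hI hR1 hR2
  have hconv : 13 / 4 * (1000 * D₁ + lR * D₂ + D₃) ≥ 13 / 4 := by
    have ha : 0 ≤ (lR + 1 / 4) * (1000 * D₁ + 3 * D₂ + D₃ - 1) := mul_nonneg (by linarith) (by linarith)
    have hb : 0 ≤ (3 - lR) * (1000 * D₁ - D₂ / 4 + D₃ - 1) := mul_nonneg (by linarith) (by linarith)
    nlinarith
  nlinarith

/-- **THE EXPONENT IS NON-NEGATIVE ALONG THE CONTOUR**: for `y′ = cτ`, `c ≥ 0`, `‖τ‖ ≤ 1`, the clause triple at `(z, τ)`, the rate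
range, and the smallness `‖α‖‖ρ‖ < 1` (`‖α‖ ≤ 4/5`, `‖ρ‖ ≤ 400/(127 Im Λ)`): `0 ≤ Re((cτ)(q − αρ))`. This is hypothesis `ha` of
`Literature.Analysis.ODE.loop_slaving_estimate`. [folklore] -/
theorem re_transport_nonneg {Λ τ cp cm bpp bmm α ρ : ℂ} {c : ℝ} (hc : 0 ≤ c) (hτ : ‖τ‖ ≤ 1)
    (h1 : 0 ≤ -(τ * (1 / cp - 1 / cm)).im) (h2 : 1 ≤ 1000 * (-(τ * (1 / cp - 1 / cm)).im) - (τ * (1 / cp - 1 / cm)).re / 4 +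
      (-(bpp * τ / cp) + bmm * τ / cm).re)
    (h3 : 1 ≤ 1000 * (-(τ * (1 / cp - 1 / cm)).im) + 3 * (τ * (1 / cp - 1 / cm)).re + (-(bpp * τ / cp) + bmm * τ / cm).re)
    (hI : 1000 ≤ Λ.im) (hR1 : -(1 / 4 : ℝ) ≤ Λ.re) (hR2 : Λ.re ≤ 3) (hα : ‖α‖ ≤ 4 / 5) (hρ : ‖ρ‖ ≤ 400 / (127 * Λ.im)) :
    0 ≤ ((c : ℂ) * τ * ((Λ - bpp) / cp - (Λ - bmm) / cm) - (c : ℂ) * τ * α * ρ).re := by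
  rw [re_transport_eq]
  have hcore := transport_core_ge_one _ _ _ _ _ h1 h2 h3 hI hR1 hR2
  have hsmall : (α * ρ * τ).re ≤ 1 := by
    have hn : ‖α * ρ * τ‖ ≤ 4 / 5 * (400 / (127 * Λ.im)) * 1 := by
      rw [norm_mul, norm_mul]
      exact mul_le_mul (mul_le_mul hα hρ (norm_nonneg _) (by norm_num)) hτ (norm_nonneg _) (by positivity)
    have hb : 4 / 5 * (400 / (127 * Λ.im)) * 1 ≤ 1 := by
      rw [mul_one, ← mul_div_assoc, div_le_one (by positivity)]; nlinarith
    exact le_trans (le_trans (le_abs_self _) (Complex.abs_re_le_norm _)) (hn.trans hb)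
  exact mul_nonneg hc (by linarith)

/-- **STEEPNESS ON THE FIRST LEG**: for the vertical tangent `τ = −η i` (`η ≥ 0`) at a point with `Re h ≥ 8/5`, `|Im h| ≤ 2/5`,
`|Im(b₊₊/c₊ − b₋₋/c₋)| ≤ 2/5` (clause (V)), the exponent is `≥ 1598·c·η` — hypothesis `hv` of `loop_slaving_estimate` with
`λ = 1598` and speed `v = cη = ‖y′‖`. [folklore] -/
theorem re_transport_ge_vertical {Λ cp cm bpp bmm α ρ : ℂ} {c η : ℝ} (hc : 0 ≤ c) (hη : 0 ≤ η)
    (hV1 : 8 / 5 ≤ (1 / cp - 1 / cm).re) (hV2 : |(1 / cp - 1 / cm).im| ≤ 2 / 5) (hV3 : |(bpp / cp - bmm / cm).im| ≤ 2 / 5)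
    (hI : 1000 ≤ Λ.im) (hR1 : -(1 / 4 : ℝ) ≤ Λ.re) (hR2 : Λ.re ≤ 3) (hα : ‖α‖ ≤ 4 / 5) (hρ : ‖ρ‖ ≤ 400 / (127 * Λ.im)) :
    1598 * (c * η) ≤ ((c : ℂ) * (-(η : ℂ) * I) * ((Λ - bpp) / cp - (Λ - bmm) / cm) - (c : ℂ) * (-(η : ℂ) * I) * α * ρ).re := by
  rw [re_transport_eq]
  -- the three tangent-dependent quantities for `τ = −η i`
  have e1 : (-((-(η : ℂ) * I) * (1 / cp - 1 / cm)).im) = η * (1 / cp - 1 / cm).re := by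
    simp [Complex.mul_im, Complex.mul_re]
  have e2 : ((-(η : ℂ) * I) * (1 / cp - 1 / cm)).re = η * (1 / cp - 1 / cm).im := by
    simp [Complex.mul_im, Complex.mul_re]
  have e3 : (-(bpp * (-(η : ℂ) * I) / cp) + bmm * (-(η : ℂ) * I) / cm).re = -(η * (bpp / cp - bmm / cm).im) := by
    have : -(bpp * (-(η : ℂ) * I) / cp) + bmm * (-(η : ℂ) * I) / cm = ((η : ℂ) * I) * (bpp / cp - bmm / cm) := by ring
    rw [this]
    simp [Complex.mul_re]
  rw [e1, e2, e3]
  have hsmall : (α * ρ * (-(η : ℂ) * I)).re ≤ η * (1 / 250) := by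
    have hn : ‖α * ρ * (-(η : ℂ) * I)‖ ≤ 4 / 5 * (400 / (127 * Λ.im)) * η := by
      rw [norm_mul, norm_mul]
      refine mul_le_mul (mul_le_mul hα hρ (norm_nonneg _) (by norm_num)) ?_ (norm_nonneg _) (by positivity)
      simp [abs_of_nonneg hη]
    have hb : 4 / 5 * (400 / (127 * Λ.im)) * η ≤ η * (1 / 250) := by
      have : 4 / 5 * (400 / (127 * Λ.im)) ≤ 1 / 250 := by
        rw [← mul_div_assoc, div_le_iff₀ (by positivity)]; nlinarith
      nlinarith
    exact le_trans (le_trans (le_abs_self _) (Complex.abs_re_le_norm _)) (hn.trans hb)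
  have hIm : Λ.re * (η * (1 / cp - 1 / cm).im) ≥ -(3 * (η * (2 / 5))) := by
    have hRe : |Λ.re| ≤ 3 := abs_le.2 ⟨by linarith, hR2⟩
    have : |Λ.re * (η * (1 / cp - 1 / cm).im)| ≤ 3 * (η * (2 / 5)) := by
      rw [abs_mul, abs_mul, abs_of_nonneg hη]
      exact mul_le_mul hRe (mul_le_mul_of_nonneg_left hV2 hη) (by positivity) (by norm_num)
    linarith [neg_abs_le (Λ.re * (η * (1 / cp - 1 / cm).im))]
  have hD3 : -(η * (bpp / cp - bmm / cm).im) ≥ -(η * (2 / 5)) := by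
    have := le_abs_self ((bpp / cp - bmm / cm).im)
    nlinarith
  have hmain : (Λ.im * η) * (8 / 5) ≤ (Λ.im * η) * (1 / cp - 1 / cm).re :=
    mul_le_mul_of_nonneg_left hV1 (mul_nonneg (by linarith) hη)
  have hextra : 0 ≤ (Λ.im - 1000) * (η * (8 / 5)) := mul_nonneg (by linarith) (by positivity)
  have hcη : 0 ≤ c * η := mul_nonneg hc hη
  have hbr : 1598 * η ≤ Λ.im * (η * (1 / cp - 1 / cm).re) + Λ.re * (η * (1 / cp - 1 / cm).im) +
      -(η * (bpp / cp - bmm / cm).im) - (α * ρ * (-(η : ℂ) * I)).re := by nlinarith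
  calc 1598 * (c * η) = c * (1598 * η) := by ring
    _ ≤ c * (Λ.im * (η * (1 / cp - 1 / cm).re) + Λ.re * (η * (1 / cp - 1 / cm).im) +
      -(η * (bpp / cp - bmm / cm).im) - (α * ρ * (-(η : ℂ) * I)).re) := mul_le_mul_of_nonneg_left hbr hc

/-- Along the contour `‖α̃‖ = ‖cτα‖ ≤ (4/5)·c·‖τ‖` — the budget `∫‖α‖` of `loop_slaving_estimate` is `(4/5)·(length)`. [folklore] -/
theorem norm_pathAlpha_le {τ α : ℂ} {c : ℝ} (hc : 0 ≤ c) (hα : ‖α‖ ≤ 4 / 5) : ‖(c : ℂ) * τ * α‖ ≤ 4 / 5 * (c * ‖τ‖) := by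
  rw [norm_mul, norm_mul, Complex.norm_real, Real.norm_eq_abs, abs_of_nonneg hc]
  nlinarith [norm_nonneg τ, mul_nonneg hc (norm_nonneg τ)]


/-- `‖Λ‖ ≤ Im Λ + 3` on the rate range. [folklore] -/
theorem norm_rate_le {Λ : ℂ} (hI : 1000 ≤ Λ.im) (hR1 : -(1 / 4 : ℝ) ≤ Λ.re) (hR2 : Λ.re ≤ 3) : ‖Λ‖ ≤ Λ.im + 3 := by
  have h := Complex.norm_le_abs_re_add_abs_im Λ
  have h1 : |Λ.re| ≤ 3 := abs_le.2 ⟨by linarith, hR2⟩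
  have h2 : |Λ.im| = Λ.im := abs_of_nonneg (by linarith)
  linarith

/-- **The derivative of `Q` is `O(|Λ|)`**: `Q′ = −b₊₊′ − k₁′(Λ − b₋₋) + k₁ b₋₋′` has `‖Q′‖ ≤ (3/5)·Im Λ + 256/25` under the (L) bounds
`‖b₊₊′‖ ≤ 4`, `‖k₁′‖ ≤ 3/5`, `‖b₋₋‖ ≤ 5`, `‖k₁‖ ≤ 9/25`, `‖b₋₋′‖ ≤ 4`. [folklore] -/
theorem norm_charQderiv_le {Λ k₁ k₁' bmm bpp1 bmm1 : ℂ} (hk : ‖k₁‖ ≤ 9 / 25) (hk' : ‖k₁'‖ ≤ 3 / 5) (hbmm : ‖bmm‖ ≤ 5)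
    (hbpp1 : ‖bpp1‖ ≤ 4) (hbmm1 : ‖bmm1‖ ≤ 4) (hI : 1000 ≤ Λ.im) (hR1 : -(1 / 4 : ℝ) ≤ Λ.re) (hR2 : Λ.re ≤ 3) :
    ‖-bpp1 - k₁' * (Λ - bmm) + k₁ * bmm1‖ ≤ 3 / 5 * Λ.im + 256 / 25 := by
  have hΛ := norm_rate_le hI hR1 hR2
  have h1 : ‖k₁' * (Λ - bmm)‖ ≤ 3 / 5 * (Λ.im + 3 + 5) := by
    rw [norm_mul]
    exact mul_le_mul hk' ((norm_sub_le _ _).trans (by linarith)) (norm_nonneg _) (by norm_num)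
  have h2 : ‖k₁ * bmm1‖ ≤ 9 / 25 * 4 := by
    rw [norm_mul]; exact mul_le_mul hk hbmm1 (norm_nonneg _) (by norm_num)
  calc ‖-bpp1 - k₁' * (Λ - bmm) + k₁ * bmm1‖ ≤ ‖-bpp1 - k₁' * (Λ - bmm)‖ + ‖k₁ * bmm1‖ := norm_add_le _ _
    _ ≤ ‖-bpp1‖ + ‖k₁' * (Λ - bmm)‖ + ‖k₁ * bmm1‖ := by linarith [norm_sub_le (-bpp1) (k₁' * (Λ - bmm))]
    _ ≤ 3 / 5 * Λ.im + 256 / 25 := by rw [norm_neg]; linarith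

/-- **THE FORCING OF THE SLAVED GAUGE IS `O(1/Im Λ)`**: with `‖Q‖ ≥ (127/200) Im Λ`, `‖Q′‖ ≤ (3/5) Im Λ + 256/25`, `‖b₊₋‖, ‖b₊₋′‖ ≤ 2`,
`‖α‖ ≤ 4/5`: `‖ρ′ + αρ²‖ = ‖(b₊₋′Q − b₊₋Q′)/Q² + α (b₊₋/Q)²‖ ≤ (25/4)/Im Λ`. Along the contour `f = y′ρ′ + (y′α)ρ²` then has
`‖f‖ ≤ (25/4)·c‖τ‖/Im Λ` — the budgets `f₁`, `Φ` of `loop_slaving_estimate`. [folklore] -/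
theorem norm_slavedForcing_le {Λ Q Q1 bpm bpm1 α : ℂ} (hQ : 127 / 200 * Λ.im ≤ ‖Q‖) (hQ1 : ‖Q1‖ ≤ 3 / 5 * Λ.im + 256 / 25)
    (hbpm : ‖bpm‖ ≤ 2) (hbpm1 : ‖bpm1‖ ≤ 2) (hα : ‖α‖ ≤ 4 / 5) (hI : 1000 ≤ Λ.im) :
    ‖(bpm1 * Q - bpm * Q1) / Q ^ 2 + α * (bpm / Q) ^ 2‖ ≤ 25 / 4 / Λ.im := by
  set q : ℝ := ‖Q‖ with hq
  have hL0 : (0 : ℝ) < Λ.im := by linarith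
  have hqpos : 0 < q := by rw [hq]; nlinarith
  have hQne : Q ≠ 0 := norm_pos_iff.1 (by rwa [hq] at hqpos)
  -- the two pieces
  have h1 : ‖(bpm1 * Q - bpm * Q1) / Q ^ 2‖ ≤ (2 * q + 2 * (3 / 5 * Λ.im + 256 / 25)) / q ^ 2 := by
    rw [norm_div, norm_pow, ← hq]
    refine div_le_div_of_nonneg_right ?_ (by positivity)
    calc ‖bpm1 * Q - bpm * Q1‖ ≤ ‖bpm1 * Q‖ + ‖bpm * Q1‖ := norm_sub_le _ _
      _ ≤ 2 * q + 2 * (3 / 5 * Λ.im + 256 / 25) := by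
          rw [norm_mul, norm_mul, ← hq]
          exact add_le_add (mul_le_mul_of_nonneg_right hbpm1 hqpos.le) (mul_le_mul hbpm hQ1 (norm_nonneg _) (by norm_num))
  have h2 : ‖α * (bpm / Q) ^ 2‖ ≤ 4 / 5 * (2 / q) ^ 2 := by
    rw [norm_mul, norm_pow, norm_div, ← hq]
    refine mul_le_mul hα ?_ (by positivity) (by norm_num)
    exact pow_le_pow_left₀ (by positivity) (div_le_div_of_nonneg_right hbpm hqpos.le) 2
  have hsum : ‖(bpm1 * Q - bpm * Q1) / Q ^ 2 + α * (bpm / Q) ^ 2‖ ≤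
      (2 * q + 2 * (3 / 5 * Λ.im + 256 / 25) + 16 / 5) / q ^ 2 := by
    refine (norm_add_le _ _).trans ?_
    have : (2 * q + 2 * (3 / 5 * Λ.im + 256 / 25) + 16 / 5) / q ^ 2 =
        (2 * q + 2 * (3 / 5 * Λ.im + 256 / 25)) / q ^ 2 + 4 / 5 * (2 / q) ^ 2 := by
      field_simp; ring
    rw [this]; exact add_le_add h1 h2
  refine hsum.trans ?_
  rw [div_le_div_iff₀ (by positivity) hL0]
  -- `(2q + 1.2 L + 23.68) L ≤ 6.25 q²` for `q ≥ 0.635 L`, `L ≥ 1000`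
  have hd : 0 ≤ q - 127 / 200 * Λ.im := by linarith
  nlinarith [mul_nonneg hd hL0.le, mul_nonneg hd hd, mul_nonneg (by linarith : (0 : ℝ) ≤ Λ.im - 1000) hL0.le]

end Summit.AtomisticToContinuum.HydrodynamicLimit.Theorems.SonicCavityRenewal

end
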